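import Literature.Analysis.FunctionSpaces.UniformlyConvexPoincare
import Literature.Analysis.Convex.Subgradient
import Literature.MathematicalPhysics.KineticTheory.LangevinChainNESSProofs
import Summits.AtomisticToContinuum.FouriersLaw.Theses.LatticeLandauDamping
import HarnessLib

/-!
# `LatticeLandauDamping.FloorGap` — the position Gibbs weight of the pinned chain is gapped

Item `stmt-AtomisticToContinuum-14015` (support, route `LatticeLandauDamping`, sub-problem
`FouriersLaw`): for `ω₂ > 0`, `lam, β ≥ 0`, every `N` and `T > 0`, the weight
`w(q) = exp(−H_pot(q)/T)`, `H_pot(q) = hamiltonian N (q, 0)` of `pinnedChain ω₂ lam β 0`, satisfies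
`Z·∫f²w − (∫fw)² ≤ (T/ω₂)·Z·∫|∇f|²w` for every `C¹` function `f` bounded with bounded partials.

Proof: the tree's PROVED Brascamp–Lieb variance inequality
`Literature.Probability.Moments.BrascampLieb1976_thm41_uniform_holds` (uniformly convex case,
first-order form of `κ`-convexity) instantiated at `Φ = H_pot/T` on `EuclideanSpace ℝ (Fin N)` with
`κ = ω₂/T`.  The first-order `κ`-convexity of `Φ` is obtained WITHOUT computing a Hessian: writing
`Φ = (κ/2)‖·‖² + Γ` with `Γ = T⁻¹(∑ lam qᵢ⁴/4 + ∑_bonds V(q_{i+1} − qᵢ))` convex (even powers composed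
with linear forms), the gradient inequality for the convex differentiable `Γ`
(`Literature.Analysis.Convex.ConvexOn.apply_add_fderiv_le`) plus the exact identity
`(κ/2)‖x‖² + κ⟪x, y − x⟫ + (κ/2)‖y − x‖² = (κ/2)‖y‖²` give
`Φ x + ⟪∇Φ x, y − x⟫ + (κ/2)‖y − x‖² ≤ Φ y`.  The rest is bookkeeping: integrability of `e^{−Φ}`
(`integrable_exp_neg_of_uniformlyConvex`), the `Z²`-multiplied form of the variance inequality (as in
`BakryEmery_poincare_of_uniformlyConvex_holds`), transport `Fin N → ℝ ≃ EuclideanSpace ℝ (Fin N)`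
(`PiLp.volume_preserving_toLp`) and `‖∇(f ∘ ofLp)‖² = ∑ᵢ (∂ᵢ f)²`.
The closing theorem is `floorGap_proof`.
-/

noncomputable section

open MeasureTheory Set Filter Topology
open scoped RealInnerProductSpace

namespace Summit.AtomisticToContinuum.FouriersLaw.Theorems

open Literature.MathematicalPhysics.KineticTheory.HeatConduction

/-! ### Poincaré inequality from first-order uniform convexity (Brascamp–Lieb, `Z²`-form) -/

/-- **Poincaré inequality for a uniformly log-concave weight, first-order hypothesis.** For
`Φ ∈ C²(ℝⁿ)` with `Φ x + ⟨∇Φ x, y − x⟩ + (κ/2)‖y − x‖² ≤ Φ y` (`κ > 0`) and `f ∈ C¹` bounded with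
bounded derivative: `(∫e^{-Φ})(∫f²e^{-Φ}) − (∫fe^{-Φ})² ≤ κ⁻¹ (∫e^{-Φ}) ∫‖∇f‖²e^{-Φ}`.
This is `Literature.Probability.Moments.BrascampLieb1976_thm41_uniform_holds` multiplied through by
`Z = ∫e^{-Φ}` (bookkeeping as in `BakryEmery_poincare_of_uniformlyConvex_holds`).
[cite: BrascampLieb1976, Thm 4.1] -/
theorem floorGap_poincare_of_firstOrderConvex {n : ℕ} {Φ : EuclideanSpace ℝ (Fin n) → ℝ}
    {κ : ℝ} (hκ : 0 < κ) (hΦ : ContDiff ℝ 2 Φ)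
    (hconv : ∀ x y : EuclideanSpace ℝ (Fin n),
      Φ x + ⟪gradient Φ x, y - x⟫ + κ / 2 * ‖y - x‖ ^ 2 ≤ Φ y)
    {f : EuclideanSpace ℝ (Fin n) → ℝ} (hf : ContDiff ℝ 1 f)
    (hbd : ∃ C : ℝ, ∀ x, |f x| ≤ C ∧ ‖fderiv ℝ f x‖ ≤ C) :
    (∫ x, Real.exp (-Φ x)) * (∫ x, f x ^ 2 * Real.exp (-Φ x)) -
        (∫ x, f x * Real.exp (-Φ x)) ^ 2 ≤
      κ⁻¹ * (∫ x, Real.exp (-Φ x)) * ∫ x, ‖gradient f x‖ ^ 2 * Real.exp (-Φ x) := by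
  obtain ⟨C, hC⟩ := hbd
  have hZ : Integrable fun x => Real.exp (-Φ x) :=
    Literature.Analysis.FunctionSpaces.integrable_exp_neg_of_uniformlyConvex hκ hΦ.continuous hconv
  have hfc : Continuous f := hf.continuous
  have hgrad : ∀ x, ‖gradient f x‖ = ‖fderiv ℝ f x‖ := fun x => by
    unfold gradient; simp
  have hgc : Continuous fun x => ‖gradient f x‖ ^ 2 := by
    simp_rw [hgrad]
    exact ((hf.continuous_fderiv one_ne_zero).norm).pow 2
  -- integrability of the three weighted integrands (bounded × integrable)
  have h1 : Integrable fun x => f x * Real.exp (-Φ x) :=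
    hZ.bdd_mul hfc.aestronglyMeasurable (Eventually.of_forall fun x => by
      rw [Real.norm_eq_abs]; exact (hC x).1)
  have h2 : Integrable fun x => f x ^ 2 * Real.exp (-Φ x) :=
    hZ.bdd_mul (c := C ^ 2) (hfc.pow 2).aestronglyMeasurable (Eventually.of_forall fun x => by
      rw [Real.norm_eq_abs, abs_of_nonneg (sq_nonneg _), ← sq_abs]
      exact pow_le_pow_left₀ (abs_nonneg _) (hC x).1 2)
  have h3 : Integrable fun x => ‖gradient f x‖ ^ 2 * Real.exp (-Φ x) :=
    hZ.bdd_mul (c := C ^ 2) hgc.aestronglyMeasurable (Eventually.of_forall fun x => by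
      rw [Real.norm_eq_abs, abs_of_nonneg (sq_nonneg _), hgrad]
      exact pow_le_pow_left₀ (norm_nonneg _) (hC x).2 2)
  -- the Brascamp–Lieb variance inequality (proved in the tree)
  have key := Literature.Probability.Moments.BrascampLieb1976_thm41_uniform_holds n Φ f κ hκ hΦ hf
    hconv hZ h1 h2 h3
  dsimp only at key
  have hZpos : 0 < ∫ x, Real.exp (-Φ x) := integral_exp_pos hZ
  set Z : ℝ := ∫ x, Real.exp (-Φ x) with hZ_def
  set A : ℝ := ∫ x, f x * Real.exp (-Φ x) with hA_def
  set B : ℝ := ∫ x, f x ^ 2 * Real.exp (-Φ x) with hB_def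
  set G : ℝ := ∫ x, ‖gradient f x‖ ^ 2 * Real.exp (-Φ x) with hG_def
  -- expand `∫ (f - A/Z)² e^{-Φ} = B - 2(A/Z)A + (A/Z)²Z`
  have e : ∀ x, (f x - A / Z) ^ 2 * Real.exp (-Φ x) =
      f x ^ 2 * Real.exp (-Φ x) - 2 * (A / Z) * (f x * Real.exp (-Φ x)) +
        (A / Z) ^ 2 * Real.exp (-Φ x) := fun x => by ring
  have hI : Integrable fun x =>
      f x ^ 2 * Real.exp (-Φ x) - 2 * (A / Z) * (f x * Real.exp (-Φ x)) :=
    h2.sub (h1.const_mul _)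
  simp_rw [e] at key
  rw [integral_add hI (hZ.const_mul _), integral_sub h2 (h1.const_mul _), integral_const_mul,
    integral_const_mul, ← hA_def, ← hB_def, ← hZ_def] at key
  -- `key : B - 2 (A/Z) A + (A/Z)² Z ≤ κ⁻¹ G`; multiply through by `Z > 0`
  have hZne : Z ≠ 0 := hZpos.ne'
  have e1 : B - 2 * (A / Z) * A + (A / Z) ^ 2 * Z = (Z * B - A ^ 2) / Z := by
    field_simp
    ring
  rw [e1, div_le_iff₀ hZpos] at key
  calc Z * B - A ^ 2 ≤ κ⁻¹ * G * Z := key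
    _ = κ⁻¹ * Z * G := by ring

/-! ### Convexity bookkeeping -/

/-- A convex function of one real variable composed with an additive, homogeneous map is convex.
[folklore] -/
theorem floorGap_convexOn_comp {E : Type*} [AddCommGroup E] [Module ℝ E] {φ : ℝ → ℝ}
    (hφ : ConvexOn ℝ univ φ) (ℓ : E → ℝ) (hadd : ∀ x y, ℓ (x + y) = ℓ x + ℓ y)
    (hsmul : ∀ (a : ℝ) (x : E), ℓ (a • x) = a * ℓ x) :
    ConvexOn ℝ univ (fun x => φ (ℓ x)) := by
  refine ⟨convex_univ, fun x _ y _ a b ha hb hab => ?_⟩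
  show φ (ℓ (a • x + b • y)) ≤ a • φ (ℓ x) + b • φ (ℓ y)
  rw [hadd, hsmul, hsmul]
  exact hφ.2 (mem_univ _) (mem_univ _) ha hb hab

/-- A finite sum of convex functions is convex. [folklore] -/
theorem floorGap_convexOn_sum {E ι : Type*} [AddCommGroup E] [Module ℝ E] (s : Finset ι)
    {g : ι → E → ℝ} (h : ∀ i ∈ s, ConvexOn ℝ univ (g i)) :
    ConvexOn ℝ univ (fun x => ∑ i ∈ s, g i x) := by
  classical
  induction s using Finset.induction_on with
  | empty => simpa using convexOn_const (0 : ℝ) convex_univ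
  | insert a s ha ih =>
    simp only [Finset.sum_insert ha]
    exact (h a (Finset.mem_insert_self a s)).add
      (ih fun i hi => h i (Finset.mem_insert_of_mem hi))

/-- Even monomials with non-negative coefficients are convex: `t ↦ c·t²/2 + d·t⁴/4` is convex on
`ℝ` for `c, d ≥ 0`. [folklore] -/
theorem floorGap_convexOn_quartic {c d : ℝ} (hc : 0 ≤ c) (hd : 0 ≤ d) :
    ConvexOn ℝ univ (fun t : ℝ => c * t ^ 2 / 2 + d * t ^ 4 / 4) := by
  have h2 := (Even.convexOn_pow (𝕜 := ℝ) (n := 2) (by decide)).smul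
    (show (0 : ℝ) ≤ c / 2 by positivity)
  have h4 := (Even.convexOn_pow (𝕜 := ℝ) (n := 4) (by decide)).smul
    (show (0 : ℝ) ≤ d / 4 by positivity)
  have h := h2.add h4
  have e : ((fun t : ℝ => (c / 2) • t ^ 2) + fun t : ℝ => (d / 4) • t ^ 4) =
      fun t : ℝ => c * t ^ 2 / 2 + d * t ^ 4 / 4 := by
    funext t
    simp only [Pi.add_apply, smul_eq_mul]
    ring
  rw [e] at h
  exact h

/-- The anharmonic part of the pinned chain's potential energy,
`x ↦ ∑ᵢ lam·xᵢ⁴/4 + ∑_{bonds} ((x_{i+1} − xᵢ)²/2 + β (x_{i+1} − xᵢ)⁴/4)`, is convex on Euclidean space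
(`lam, β ≥ 0`). [folklore] -/
theorem floorGap_convexOn_anharmonic {lam β : ℝ} (hl : 0 ≤ lam) (hβ : 0 ≤ β) (N : ℕ) :
    ConvexOn ℝ univ (fun x : EuclideanSpace ℝ (Fin N) =>
      (∑ i, lam * (WithLp.ofLp x) i ^ 4 / 4) +
        ∑ i : Fin N, ∑ j : Fin N,
          if j.val = i.val + 1 then
            ((WithLp.ofLp x) j - (WithLp.ofLp x) i) ^ 2 / 2 +
              β * ((WithLp.ofLp x) j - (WithLp.ofLp x) i) ^ 4 / 4
          else 0) := by
  have hA : ConvexOn ℝ univ (fun x : EuclideanSpace ℝ (Fin N) =>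
      ∑ i, lam * (WithLp.ofLp x) i ^ 4 / 4) := by
    refine floorGap_convexOn_sum _ fun i _ => ?_
    have h := floorGap_convexOn_comp (floorGap_convexOn_quartic le_rfl hl)
      (fun x : EuclideanSpace ℝ (Fin N) => (WithLp.ofLp x) i)
      (fun x y => by simp) (fun a x => by simp)
    refine ⟨convex_univ, fun x hx y hy a b ha hb hab => ?_⟩
    have := h.2 hx hy ha hb hab
    simp only [zero_mul, zero_div, zero_add, smul_eq_mul] at this ⊢
    exact this
  have hB : ConvexOn ℝ univ (fun x : EuclideanSpace ℝ (Fin N) =>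
      ∑ i : Fin N, ∑ j : Fin N,
        if j.val = i.val + 1 then
          ((WithLp.ofLp x) j - (WithLp.ofLp x) i) ^ 2 / 2 +
            β * ((WithLp.ofLp x) j - (WithLp.ofLp x) i) ^ 4 / 4
        else 0) := by
    refine floorGap_convexOn_sum _ fun i _ => floorGap_convexOn_sum _ fun j _ => ?_
    by_cases hij : j.val = i.val + 1
    · simp only [hij, if_true]
      have h := floorGap_convexOn_comp (floorGap_convexOn_quartic zero_le_one hβ)
        (fun x : EuclideanSpace ℝ (Fin N) => (WithLp.ofLp x) j - (WithLp.ofLp x) i)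
        (fun x y => by simp only [WithLp.ofLp_add, Pi.add_apply]; ring)
        (fun a x => by simp only [WithLp.ofLp_smul, Pi.smul_apply, smul_eq_mul]; ring)
      refine ⟨convex_univ, fun x hx y hy a b ha hb hab => ?_⟩
      have := h.2 hx hy ha hb hab
      simp only [one_mul, smul_eq_mul] at this ⊢
      exact this
    · simp only [hij, if_false]
      exact convexOn_const (0 : ℝ) convex_univ
  exact hA.add hB

/-! ### The pinned chain: potential energy, first-order convexity, regularity -/

/-- The potential energy of `pinnedChain ω₂ lam β 0` at momenta `0`, in closed form:
`H(q, 0) = (ω₂/2) ∑ qᵢ² + (∑ lam qᵢ⁴/4 + ∑_{bonds} ((q_{i+1} − qᵢ)²/2 + β (q_{i+1} − qᵢ)⁴/4))`.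
[folklore] -/
theorem floorGap_hamiltonian_q_eq (ω₂ lam β : ℝ) (N : ℕ) (q : Fin N → ℝ) :
    (pinnedChain ω₂ lam β 0).hamiltonian N (q, fun _ => 0) =
      ω₂ / 2 * ∑ i, q i ^ 2 +
        ((∑ i, lam * q i ^ 4 / 4) +
          ∑ i : Fin N, ∑ j : Fin N,
            if j.val = i.val + 1 then ((q j - q i) ^ 2 / 2 + β * (q j - q i) ^ 4 / 4) else 0) := by
  simp only [OscillatorChain.hamiltonian, pinnedChain]
  have hA : ∑ i : Fin N, ((0 : ℝ) ^ 2 / 2 + (ω₂ * q i ^ 2 / 2 + lam * q i ^ 4 / 4)) =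
      ω₂ / 2 * ∑ i, q i ^ 2 + ∑ i, lam * q i ^ 4 / 4 := by
    rw [Finset.mul_sum, ← Finset.sum_add_distrib]
    exact Finset.sum_congr rfl fun i _ => by ring
  rw [hA]
  ring

/-- **First-order `ω₂/T`-convexity of `Φ = H_pot/T`** on Euclidean space: for `lam, β ≥ 0`, `T > 0`,
`Φ x + ⟨∇Φ x, y − x⟩ + (ω₂/T)/2 · ‖y − x‖² ≤ Φ y`. From the split `Φ = (κ/2)‖·‖² + Γ` with `Γ`
convex and differentiable (gradient inequality for `Γ`). [folklore] -/
theorem floorGap_firstOrderConvex {ω₂ lam β T : ℝ} (hl : 0 ≤ lam) (hβ : 0 ≤ β) (hT : 0 < T)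
    (N : ℕ) (x y : EuclideanSpace ℝ (Fin N)) :
    (fun z : EuclideanSpace ℝ (Fin N) =>
        (pinnedChain ω₂ lam β 0).hamiltonian N (WithLp.ofLp z, fun _ => 0) / T) x +
      ⟪gradient (fun z : EuclideanSpace ℝ (Fin N) =>
          (pinnedChain ω₂ lam β 0).hamiltonian N (WithLp.ofLp z, fun _ => 0) / T) x, y - x⟫ +
      ω₂ / T / 2 * ‖y - x‖ ^ 2 ≤
    (fun z : EuclideanSpace ℝ (Fin N) =>
        (pinnedChain ω₂ lam β 0).hamiltonian N (WithLp.ofLp z, fun _ => 0) / T) y := by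
  set Φ : EuclideanSpace ℝ (Fin N) → ℝ := fun z =>
    (pinnedChain ω₂ lam β 0).hamiltonian N (WithLp.ofLp z, fun _ => 0) / T with hΦ_def
  set κ : ℝ := ω₂ / T with hκ_def
  -- regularity of `Φ`
  have hHc : ContDiff ℝ 2 fun q : Fin N → ℝ =>
      (pinnedChain ω₂ lam β 0).hamiltonian N (q, fun _ => 0) :=
    ((pinnedChain ω₂ lam β 0).contDiff_hamiltonian (pinnedChain_contDiff_U ω₂ lam β 0)
      (pinnedChain_contDiff_V ω₂ lam β 0) N).comp (contDiff_id.prodMk contDiff_const)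
  have hΦc : ContDiff ℝ 2 Φ := (hHc.comp PiLp.contDiff_ofLp).div_const T
  have hΦd : Differentiable ℝ Φ := hΦc.differentiable (by norm_num)
  -- the convex remainder `Γ = Φ − (κ/2)‖·‖²`
  set Γ : EuclideanSpace ℝ (Fin N) → ℝ := fun z => Φ z - κ / 2 * ‖z‖ ^ 2 with hΓ_def
  have hQ : ∀ z : EuclideanSpace ℝ (Fin N),
      HasFDerivAt (fun w : EuclideanSpace ℝ (Fin N) => κ / 2 * ‖w‖ ^ 2)
        ((κ / 2) • (2 • innerSL ℝ z)) z := fun z =>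
    (hasStrictFDerivAt_norm_sq z).hasFDerivAt.const_mul (κ / 2)
  have hΓd : HasFDerivAt Γ (fderiv ℝ Φ x - (κ / 2) • (2 • innerSL ℝ x)) x :=
    (hΦd x).hasFDerivAt.sub (hQ x)
  -- explicit form of `Γ`
  have hΓ_eq : ∀ z : EuclideanSpace ℝ (Fin N), Γ z = T⁻¹ •
      ((∑ i, lam * (WithLp.ofLp z) i ^ 4 / 4) +
        ∑ i : Fin N, ∑ j : Fin N,
          if j.val = i.val + 1 then
            ((WithLp.ofLp z) j - (WithLp.ofLp z) i) ^ 2 / 2 +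
              β * ((WithLp.ofLp z) j - (WithLp.ofLp z) i) ^ 4 / 4
          else 0) := fun z => by
    simp only [hΓ_def, hΦ_def, hκ_def, floorGap_hamiltonian_q_eq, EuclideanSpace.real_norm_sq_eq,
      smul_eq_mul]
    ring
  have hΓconv : ConvexOn ℝ univ Γ := by
    have h := (floorGap_convexOn_anharmonic hl hβ N).smul (inv_nonneg.mpr hT.le : (0 : ℝ) ≤ T⁻¹)
    rw [show Γ = _ from funext hΓ_eq]
    exact h
  -- the gradient inequality for `Γ`
  have key := Literature.Analysis.Convex.ConvexOn.apply_add_fderiv_le hΓconv (mem_univ x) hΓd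
    (mem_univ y)
  simp only [hΓ_def, _root_.sub_apply, _root_.smul_apply,
    innerSL_apply_apply, smul_eq_mul, nsmul_eq_mul, Nat.cast_ofNat] at key
  rw [inner_gradient_left]
  have e1 : ‖y - x‖ ^ 2 = ‖y‖ ^ 2 - 2 * ⟪y, x⟫ + ‖x‖ ^ 2 := norm_sub_sq_real y x
  have e2 : ⟪x, y - x⟫ = ⟪x, y⟫ - ‖x‖ ^ 2 := by
    rw [inner_sub_right, real_inner_self_eq_norm_sq]
  have e3 : ⟪y, x⟫ = ⟪x, y⟫ := real_inner_comm _ _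
  rw [e1, e3]
  rw [e2] at key
  show Φ x + (fderiv ℝ Φ x) (y - x) + κ / 2 * (‖y‖ ^ 2 - 2 * ⟪x, y⟫ + ‖x‖ ^ 2) ≤ Φ y
  linarith [key]

/-- For `f` differentiable on `ℝ^N` and `F = f ∘ ofLp` on Euclidean space, the `i`-th coordinate of
`∇F` is the partial derivative `∂ᵢ f` (derivative along `Function.update`). [folklore] -/
theorem floorGap_gradient_apply {N : ℕ} {f : (Fin N → ℝ) → ℝ} (hf : Differentiable ℝ f)
    (x : EuclideanSpace ℝ (Fin N)) (i : Fin N) :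
    WithLp.ofLp (gradient (fun y : EuclideanSpace ℝ (Fin N) => f (WithLp.ofLp y)) x) i =
      deriv (fun s : ℝ => f (Function.update (WithLp.ofLp x) i s)) (WithLp.ofLp x i) := by
  have he : HasFDerivAt (fun y : EuclideanSpace ℝ (Fin N) => f (WithLp.ofLp y))
      ((fderiv ℝ f (WithLp.ofLp x)).comp
        (PiLp.continuousLinearEquiv 2 ℝ (fun _ : Fin N => ℝ)).toContinuousLinearMap) x :=
    (hf (WithLp.ofLp x)).hasFDerivAt.comp x (PiLp.hasFDerivAt_ofLp (𝕜 := ℝ) 2 x)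
  have h1 : WithLp.ofLp (gradient (fun y : EuclideanSpace ℝ (Fin N) => f (WithLp.ofLp y)) x) i =
      ⟪gradient (fun y : EuclideanSpace ℝ (Fin N) => f (WithLp.ofLp y)) x,
        EuclideanSpace.single i (1 : ℝ)⟫ := by
    rw [EuclideanSpace.inner_single_right]
    simp
  rw [h1, inner_gradient_left, he.fderiv, ContinuousLinearMap.comp_apply]
  have h2 : (PiLp.continuousLinearEquiv 2 ℝ (fun _ : Fin N => ℝ)).toContinuousLinearMap
      (EuclideanSpace.single i (1 : ℝ)) = Pi.single i 1 := rfl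
  rw [h2]
  have h3 : HasDerivAt (fun s : ℝ => f (Function.update (WithLp.ofLp x) i s))
      (fderiv ℝ f (WithLp.ofLp x) (Pi.single i 1)) (WithLp.ofLp x i) := by
    have hu := hasDerivAt_update (WithLp.ofLp x) i (WithLp.ofLp x i)
    have hfd : HasFDerivAt f (fderiv ℝ f (WithLp.ofLp x))
        (Function.update (WithLp.ofLp x) i (WithLp.ofLp x i)) := by
      rw [Function.update_eq_self]
      exact (hf _).hasFDerivAt
    exact hfd.comp_hasDerivAt _ hu
  rw [h3.deriv]

/-- `‖∇(f ∘ ofLp)‖² = ∑ᵢ (∂ᵢ f)²` on Euclidean space. [folklore] -/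
theorem floorGap_norm_gradient_sq {N : ℕ} {f : (Fin N → ℝ) → ℝ} (hf : Differentiable ℝ f)
    (x : EuclideanSpace ℝ (Fin N)) :
    ‖gradient (fun y : EuclideanSpace ℝ (Fin N) => f (WithLp.ofLp y)) x‖ ^ 2 =
      ∑ i : Fin N, (deriv (fun s : ℝ => f (Function.update (WithLp.ofLp x) i s))
        (WithLp.ofLp x i)) ^ 2 := by
  rw [EuclideanSpace.real_norm_sq_eq]
  exact Finset.sum_congr rfl fun i _ => by rw [floorGap_gradient_apply hf x i]

/-! ### The item -/

/-- **FloorGap, normalised form**: for `ω₂ > 0`, `lam, β ≥ 0`, `T > 0`, every `N` and every `C¹`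
function `f` on `ℝ^N` bounded with bounded partial derivatives, with
`w(q) = exp(−H(q,0)/T)` for `H` the Hamiltonian of `pinnedChain ω₂ lam β 0`:
`(∫w)(∫f²w) − (∫fw)² ≤ (T/ω₂)(∫w)∫(∑ᵢ(∂ᵢf)²)w`. [cite: BrascampLieb1976, Thm 4.1] -/
theorem floorGap_main {ω₂ lam β : ℝ} (hω : 0 < ω₂) (hl : 0 ≤ lam) (hβ : 0 ≤ β) (N : ℕ) {T : ℝ}
    (hT : 0 < T) (f : (Fin N → ℝ) → ℝ) (hf : ContDiff ℝ 1 f)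
    (hbd : ∃ C : ℝ, ∀ q : Fin N → ℝ, |f q| ≤ C ∧
      ∀ i : Fin N, |deriv (fun s : ℝ => f (Function.update q i s)) (q i)| ≤ C) :
    (∫ q : Fin N → ℝ, Real.exp (-((pinnedChain ω₂ lam β 0).hamiltonian N (q, fun _ => 0) / T))) *
        (∫ q : Fin N → ℝ, f q ^ 2 *
          Real.exp (-((pinnedChain ω₂ lam β 0).hamiltonian N (q, fun _ => 0) / T))) -
      (∫ q : Fin N → ℝ, f q *
          Real.exp (-((pinnedChain ω₂ lam β 0).hamiltonian N (q, fun _ => 0) / T))) ^ 2 ≤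
    (T / ω₂) *
      (∫ q : Fin N → ℝ, Real.exp (-((pinnedChain ω₂ lam β 0).hamiltonian N (q, fun _ => 0) / T))) *
      ∫ q : Fin N → ℝ, (∑ i : Fin N, (deriv (fun s : ℝ => f (Function.update q i s)) (q i)) ^ 2) *
        Real.exp (-((pinnedChain ω₂ lam β 0).hamiltonian N (q, fun _ => 0) / T)) := by
  set Φ : EuclideanSpace ℝ (Fin N) → ℝ := fun z =>
    (pinnedChain ω₂ lam β 0).hamiltonian N (WithLp.ofLp z, fun _ => 0) / T with hΦ_def
  set F : EuclideanSpace ℝ (Fin N) → ℝ := fun z => f (WithLp.ofLp z) with hF_def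
  have hκ : 0 < ω₂ / T := div_pos hω hT
  -- regularity
  have hHc : ContDiff ℝ 2 fun q : Fin N → ℝ =>
      (pinnedChain ω₂ lam β 0).hamiltonian N (q, fun _ => 0) :=
    ((pinnedChain ω₂ lam β 0).contDiff_hamiltonian (pinnedChain_contDiff_U ω₂ lam β 0)
      (pinnedChain_contDiff_V ω₂ lam β 0) N).comp (contDiff_id.prodMk contDiff_const)
  have hΦc : ContDiff ℝ 2 Φ := (hHc.comp PiLp.contDiff_ofLp).div_const T
  have hFc : ContDiff ℝ 1 F := hf.comp PiLp.contDiff_ofLp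
  have hfd : Differentiable ℝ f := hf.differentiable one_ne_zero
  -- first-order convexity
  have hconv : ∀ x y : EuclideanSpace ℝ (Fin N),
      Φ x + ⟪gradient Φ x, y - x⟫ + ω₂ / T / 2 * ‖y - x‖ ^ 2 ≤ Φ y :=
    fun x y => floorGap_firstOrderConvex hl hβ hT N x y
  -- bounds on `F` and `DF`
  obtain ⟨C, hC⟩ := hbd
  have hC0 : 0 ≤ C := (abs_nonneg _).trans (hC fun _ => 0).1
  have hgrad : ∀ x, ‖gradient F x‖ = ‖fderiv ℝ F x‖ := fun x => by
    unfold gradient; simp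
  have hbdF : ∃ C' : ℝ, ∀ x, |F x| ≤ C' ∧ ‖fderiv ℝ F x‖ ≤ C' := by
    refine ⟨C + N * C, fun x => ⟨?_, ?_⟩⟩
    · have := (hC (WithLp.ofLp x)).1
      have hN : (0 : ℝ) ≤ N * C := by positivity
      simp only [hF_def]
      linarith
    · rw [← hgrad]
      have hsq : ‖gradient F x‖ ^ 2 ≤ (C + N * C) ^ 2 := by
        calc ‖gradient F x‖ ^ 2
            = ∑ i : Fin N, (deriv (fun s : ℝ => f (Function.update (WithLp.ofLp x) i s))
                (WithLp.ofLp x i)) ^ 2 := floorGap_norm_gradient_sq hfd x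
          _ ≤ ∑ _i : Fin N, C ^ 2 := Finset.sum_le_sum fun i _ => by
              rw [← sq_abs]
              exact pow_le_pow_left₀ (abs_nonneg _) ((hC (WithLp.ofLp x)).2 i) 2
          _ = N * C ^ 2 := by simp
          _ ≤ (C + N * C) ^ 2 := by
              have hN : (0 : ℝ) ≤ N := Nat.cast_nonneg N
              nlinarith [sq_nonneg C, mul_nonneg hN (sq_nonneg C),
                mul_nonneg (mul_nonneg hN hN) (sq_nonneg C)]
      have hN : (0 : ℝ) ≤ C + N * C := by positivity
      exact (pow_le_pow_iff_left₀ (norm_nonneg _) hN two_ne_zero).1 hsq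
  -- the Poincaré inequality on Euclidean space
  have key := floorGap_poincare_of_firstOrderConvex hκ hΦc hconv hFc hbdF
  -- transport to `Fin N → ℝ`
  have hI : ∀ g : EuclideanSpace ℝ (Fin N) → ℝ,
      ∫ x, g x = ∫ q : Fin N → ℝ, g (WithLp.toLp 2 q) := fun g =>
    ((PiLp.volume_preserving_toLp (Fin N)).integral_comp
      (MeasurableEquiv.toLp 2 (Fin N → ℝ)).measurableEmbedding g).symm
  rw [hI, hI, hI, hI] at key
  simp only [hF_def, hΦ_def, floorGap_norm_gradient_sq hfd, inv_div] at key
  exact key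

open Summit.AtomisticToContinuum.FouriersLaw.Theses.LatticeLandauDamping in
/-- **FloorGap** (item `stmt-AtomisticToContinuum-14015`): the position Gibbs weight
`w = exp(−H_pot/T)` of `pinnedChain ω₂ lam β 0` (`ω₂ > 0`, `lam, β ≥ 0`) has spectral gap `≥ ω₂/T`
uniformly in `N`: `Z·∫f²w − (∫fw)² ≤ (T/ω₂)·Z·∫(∑ᵢ(∂ᵢf)²)w` for every `C¹` `f` bounded with bounded
partials. Brascamp–Lieb 1976, Thm 4.1 (uniformly convex case, `Hess H_pot ≥ ω₂`), via the tree's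
`BrascampLieb1976_thm41_uniform_holds`. [cite: BrascampLieb1976, Thm 4.1] -/
theorem floorGap_proof : FloorGap := by
  intro ω₂ lam β hω hl hβ N T hT f hf hbd
  have h := floorGap_main hω hl hβ N hT f hf hbd
  simp only [neg_div] at h ⊢
  exact h

end Summit.AtomisticToContinuum.FouriersLaw.Theorems

end
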